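import Mathlib
import Summits.ValiantsHypothesis.ValiantsHypothesis.Theses.DetQP
import Literature.Computability.AlgebraicComplexity.DeterminantalComplexity
import Literature.Computability.AlgebraicComplexity.DeterminantalComplexityProofs
import Literature.Computability.AlgebraicComplexity.DeterminantalConormalBound
import Literature.Computability.AlgebraicComplexity.DeterminantalConormalBoundMixed
import Literature.Computability.AlgebraicComplexity.StandardFamilies
import Summits.ValiantsHypothesis.ValiantsHypothesis.Theorems.DetQPDetqpSuperquadraticStubBezoutGrowth
import Summits.ValiantsHypothesis.ValiantsHypothesis.Theorems.DetQPDetqpSuperquadraticStubPolarPersistence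
import Summits.ValiantsHypothesis.ValiantsHypothesis.Theorems.DetQPDetqpSuperquadraticStubPolarGenericFinite
import Summits.ValiantsHypothesis.ValiantsHypothesis.Theorems.DetQPDetqpSuperquadraticStubPolarPersistenceND
import Summits.ValiantsHypothesis.ValiantsHypothesis.Theorems.DetQPDetqpSuperquadraticStubPolarCountND

/-!
# Line `sectional-class-ladder` — skeleton v3 (lead c1, 2026-08-16 14:20Z: CLOSED MODULO `stub_sectionalWitness` — every other stub is an imported tree theorem; held unchanged by lead c2 (reduction `stub_cruxOfSectionalWitness : stub 1 ⟹ crux` landed, p145315) and by lead c3 from 2026-08-17 07:40Z, who measured the sectional-class ladders of P_5…P_8 — `Lines/sectional-class-ladder-c3-results.md`) for crux `DetQP.DetqpSuperquadratic`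
# (stmt-ValiantsHypothesis-0318; routes DetQP (decl `DetqpSuperquadratic`, rank 2) and
# UlrichPadded (decl `Superquadratic`, rank 5); crux-plan, round 1)

**Crux (fixed).** `∃ ε > 0, ∃ n₀, ∀ n ≥ n₀, (n:ℝ)^(2+ε) ≤ dc(per_n)` over `ℂ`
(`Literature.Computability.AlgebraicComplexity.determinantalComplexity (perPoly (Fin n) ℂ)`).

**Idea (card `Ideas/sectional-class-ladder.md`, ideator 3; triage r1: pass × 3).**  Grade the
polar/class invariant of the permanental hypersurface `P_n = V(per_n) ⊂ ℙ^{n²-1}` by the INDEX of a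
linear section instead of using the top index: for a linear restriction `g = per_n ∘ L` of `per_n`
to `k + 2` variables, the number of points of the polar set `T_g(a,b,c)` (smooth points of `V(g)`
whose tangent hyperplane lies on the pencil `⟨a,b⟩`, one representative on the chart `c·x = 1`;
`Literature…polarSet`) is, for generic data, the class of the `(k+1)`-plane section
`V(per_n) ∩ ℙ^{k+1}`.  DET SIDE (a theorem, proved below from the tree): affine determinantal
representations survive linear substitution, so the in-tree two-kernel Bézout bound
`Sheshadri2026_polarCount_le` — DISCHARGED in tree as `Sheshadri2026_polarCount_le_holds`
(DeterminantalConormalBoundMixed.lean, multigraded refined Bézout count) — applies verbatim to every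
section: generically `#T_g(a,b,c) ≤ B(dc(per_n), k+2)` (`ladder_rung`).  Since
`B(m, k+2) ≤ 2^k·C(2m-1, k+1) ≤ ½ (4em/(k+1))^{k+1}`, a rung `k ≥ n^{1+ε}` carrying `n^{(1-θ)k}` polar
points (`θ < ε`) forces `dc(per_n) ≥ n^{2+ε-θ}/(8e)` (`stub_bezoutGrowth`).  PER SIDE (the bet): the
**sectional class bound** `SectionalClassBound ε θ` — some `(k+2)`-variable section of `per_n`,
`k ≥ n^{1+ε}`, has generic polar count `≥ n^{(1-θ)k}` — because the section of a smooth degree-`n`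
hypersurface has class `n(n-1)^k` exactly and, past `k + 2 = codim Sing P_n` (`= 2n` conjecturally,
Landsberg Q 6.3.3.7; `≥ 5` by von zur Gathen), the deficit is governed only by the SHALLOW singular
strata of `P_n` (codimension `≤ k+1`: König zero blocks, bordered/Laplace cones over `P_{n-1}`,
`{row = 0} × PM_full`), which spend half their codimension on forced zero entries (census (Z′),
item evidence `census-sing-strata.md`, n ≤ 6) and so cost a vanishing fraction of `n(n-1)^k`.

**Shape.**  `DetqpSuperquadratic_of : DetQP.DetqpSuperquadratic` (no hypotheses) is proved here
from four registered stubs; `sorry` occurs only inside `stub_*`; every stub statement mentions only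
Mathlib and `Literature.*` declarations (so each lands as `Theorems/DetqpSuperquadratic<Stub>.lean`
with `--supports stmt-ValiantsHypothesis-0318`).  The per side is cut along PROOF TECHNIQUE, not
along the crux:
* `stub_sectionalWitness` — THE LOAD-BEARING CONJECTURE in certificate form: one section `L`, ONE
  pencil/chart datum `(a,b,c)` and a finite set of `≥ n^{(1-θ)k}` polar points of `per_n ∘ L` that
  are NON-DEGENERATE zeros of the square polar system (bordered-Hessian Jacobian invertible);
* `stub_polarPersistence` — lower semicontinuity of the polar count (implicit function theorem:
  non-degenerate polar points at one datum persist to every datum off any hypersurface `Φ = 0`);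
* `stub_polarGenericFinite` — generic finiteness of polar sets of a form (dimension count on the
  conormal variety: `dim C_X = N - 2`, a generic pencil is a generic line of `(ℙ^{N-1})^∨`);
* `stub_bezoutGrowth` — the growth lemma for Sheshadri's number `B(m, k+2)` and the extraction of
  the exponent `2 + (ε-θ)/2`.
The TRANSFER of the card is made literal: `SectionalClassBound ε θ` (C⁺, the sharpened sectional
class conjecture: decoupled exponents, single rung, robust base — triage r1-1/r1-3) is DERIVED from
the first three stubs (`exists_sectionalClassBound`) and IMPLIES the crux through the proved rung and
the growth stub (`detqpSuperquadratic_of_sectionalClassBound`).  Route UlrichPadded's decl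
`UlrichPadded.Superquadratic` (the same item, rank 5 there) is literally the same proposition, so
`DetqpSuperquadratic_of` proves it by `exact`; that route file is deliberately NOT imported (one living
route file per skeleton keeps the farm-coherence surface minimal).

**Disproof used** (cdisprove v1–v4 for this crux, evidence `Disproof.lean` 2026-08-15T22:44:54Z; the
crux workfile `Cruxes/DetqpSuperquadratic/Disproof.lean` is not yet published and the evidence store
is not mounted in planner jails — read through its evidence notes and triage r1-1):
`superquadratic_false_without_charZero` (per = det in char 2) — honoured: everything is over `ℂ`, and
the char-0 content enters at `stub_sectionalWitness` (in char 2 the dual of every section collapses,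
Sheshadri Rem. 3) and at `ladder_rung` (Kleiman/Bézout over `ℂ`); `threshold_ge_five` (every witness
has `n₀ ≥ 5`) — honoured: `n₀` is existential, supplied by `stub_sectionalWitness`/`stub_bezoutGrowth`,
never fixed below 5; `mr_method` / `mr_method_ceiling_perPoly` (Hessian-rank engine caps at `n²/2`) and
`perPoly_singular_on_two_zero_rows` (singular-locus engine caps at `2n+1`) — this line uses neither
engine: its invariant is an intersection NUMBER of a section of dimension `~n^{1+ε}`, and
`conormalBezout_eq_zero_of_lt` shows the MR/LMR floor is exactly rung information `B = 0`;
`superquadratic_iff_natPow` (cast-free form) — available to the prover of `stub_bezoutGrowth`, not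
needed by the skeleton.  No `Negative/` lemma has landed for this crux (nothing to import); no stub is
an instance of a refuted strengthening (super-Grenet growth is not asserted anywhere: the line's
ceiling is `dc ≳ n³`, horn 1 of the Bézout ceiling card).  Negatives index (5668, 0340, 3735, 3738):
unrelated statements, none restated.
-/

namespace Summit.ValiantsHypothesis.ValiantsHypothesis.Cruxes.DetqpSuperquadratic.SectionalClassLadder

open MvPolynomial
open scoped BigOperators Matrix
open Literature.Computability.AlgebraicComplexity

set_option linter.dupNamespace false
set_option linter.unusedVariables false

noncomputable section

/-! ## The four stubs -/

/-- **Stub 1 (per side, LOAD-BEARING, the line's conjecture in certificate form) — sectional class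
witnesses.**  STATUS (lead c3, 2026-08-17): the ONLY open stub (everything else is an imported tree theorem; the reduction
`stub 1 ⟹ crux` is itself landed, `Theorems/DetQPDetqpSuperquadraticStubCruxOfSectionalWitness.lean`, p145315); PASSED its
pre-registered falsification test at n = 6, 7, 8 (lead c3, `Lines/sectional-class-ladder-c3-prereg.md` / `-c3-results.md`: the generic
ladders measured by an independent subsampled polar homotopy give k×(n;½) := last rung with δ_k/δ_{k−1} ≥ √n = 8, 13, 21, 31, 38 for
n = 4..8, i.e. ≈ (0.50, 0.52, 0.58, 0.63, 0.59)·n², against the 'dying' predictions 24 (n = 7) / 29 (n = 8); peak polar rank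
log_n max_k δ_k(P_n) ≈ (0.46, 0.51, 0.56, 0.58, 0.61)·n² for n = 4..8 — the whole profile scales with n² as far as measured);
numerically SUPPORTED for n ≤ 6 by lead c1 (item evidence `scl-ladder-v4.md`: the generic ladders δ_k(P_n), n = 3..6 — by
semicontinuity exactly the quantity this stub needs — satisfy δ_k ≥ n^{(1−θ)k} with θ < ε_k := log_n k − 1 at EVERY
measured rung, margins +.17/+.39/≥+.51/≥+.53 growing with n; the post-smooth ratio profile log_n(δ_k/δ_{k−1}) =
(.69,.52,.29,.04,…) | (.85,.83,.79,.73,.64,.51) | (≈.89,.89,.87,.87,.84,.84) at n = 4 | 5 | 6 flattens with n).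
Sharpened research form SC♯: the decay scale s(n) of that profile satisfies s(n) ≥ n^{1+σ} for some σ > 0
(⟹ SC(ε,θ) for θ < ε < σ ⟹ dc(per_n) ≥ n^{2+(ε−θ)/2}).  Crux-incomparable, to be PROMOTED.  Original description:  There are exponents `0 < θ < ε` such that for all large `n` some rung `k ≥ n^{1+ε}`
carries a `(k+2)`-variable linear section `g = per_n ∘ L` (`L` a matrix of linear forms), ONE
pencil/chart datum `(a, b, c)` and a finite set `F` of at least `n^{(1-θ)k}` points of the polar set
`T_g(a,b,c)` each of which is a NON-DEGENERATE zero of the square polar system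
`{g(x) = 0, ∂ᵢg(x) = s·aᵢ + t·bᵢ (i ≤ k+1), c·x = 1}` in the unknowns `(x, s, t)`, i.e. the bordered
Hessian Jacobian `[[∂ᵢ∂ⱼg(x), (aᵢ bᵢ)], [(∂ⱼg(x); cⱼ), 0]]` is invertible (sign/row order immaterial).
Why plausibly true: for `k + 2 ≤ codim Sing V(per_n)` a generic section is a SMOOTH degree-`n`
hypersurface in `ℙ^{k+1}`, whose class is `n(n-1)^k` (Plücker–Teissier), realised for a generic datum
by `n(n-1)^k` reduced (= non-degenerate, Kleiman transversality in char 0) polar points; past that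
threshold the class deficit is `Σ_strata` (polar classes of the closure of each singular stratum of
codim `≤ k+1` × transversal Milnor data) (Teissier for isolated points: `d(d-1)^k − Σ(μ+μ′)`; Piene 1978
/ Aluffi for non-isolated), and the shallow strata of `P_n` are König zero blocks (linear), bordered
cones `{row i = col j = 0, per_{n-1}(minor) = 0}` (the ladder one size down) and `{row = 0} × PM_full`,
all transversally `A₁`, each of degree `≤ (n-1)^{codim/2}` instead of the Bézout-allowed
`(n-1)^{codim}` (conjecture (Z′); witness-set census n ≤ 6 in the item evidence), so the deficit at
rung `k ≈ n^{1+ε}` is a `(n-1)^{-Ω(n)}`-fraction per stratum and `δ_k ≥ n^{(1-θ)k}` survives for any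
fixed `θ > 0`; first informative number: `(δ₇,…,δ₁₀)(P₄)` (prediction `≈ 4·3^k − 2·#Sing-points`,
triage r1-2).  Why it might fail: a family of components of `Sing(P_n)` of codimension `c = O(n^{1+ε})`
with few forced zeros and degree `(n-1)^{c-O(1)}`, or transversal types degenerating along
positive-dimensional sub-loci, would inject a full-size deficit (log-concavity then caps every later
rung).  Size XL (research; the first finite dividends are the MR-beating rung `k ≈ 10n`, base `n/2`,
and the census to codim `6n` at `n = 5, 6`).  [Landsberg2017 §6.3.3 Q 6.3.3.7; Vonzurgathen1987
Lemma 2.3; arXiv:2402.17839 §4; arXiv:1312.2577; Piene1978; Teissier1973; Fulton1998 Ch. 12;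
arXiv:2606.13628 Thm 3(i)] -/
theorem stub_sectionalWitness :
    ∃ ε θ : ℝ, 0 < θ ∧ θ < ε ∧ ∃ n₀ : ℕ, ∀ n ≥ n₀, ∃ k : ℕ, (n : ℝ) ^ (1 + ε) ≤ (k : ℝ) ∧
      ∃ L : Fin n × Fin n → MvPolynomial (Fin (k + 2)) ℂ, (∀ ij, (L ij).IsHomogeneous 1) ∧
        ∃ (a b c : Fin (k + 2) → ℂ) (F : Finset (Fin (k + 2) → ℂ)),
          (∀ x ∈ F, x ∈ polarSet (aeval L (perPoly (Fin n) ℂ)) a b c ∧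
            (Matrix.fromBlocks
              (Matrix.of fun i j : Fin (k + 2) =>
                eval x (pderiv i (pderiv j (aeval L (perPoly (Fin n) ℂ)))))
              (Matrix.of fun (i : Fin (k + 2)) (l : Fin 2) => ![a i, b i] l)
              (Matrix.of fun (l : Fin 2) (j : Fin (k + 2)) =>
                ![eval x (pderiv j (aeval L (perPoly (Fin n) ℂ))), c j] l)
              (0 : Matrix (Fin 2) (Fin 2) ℂ)).det ≠ 0) ∧
          (n : ℝ) ^ ((1 - θ) * (k : ℝ)) ≤ (F.card : ℝ) := by
  sorry

/-- **Stub 2 — LANDED p98143 (`Theorems/DetQPDetqpSuperquadraticStubPolarPersistence.lean`, wave 1; imported once the farm has built it)** (general, TRUE: lower semicontinuity of the polar count) — persistence of non-degenerate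
polar points.**  If at one datum `(a, b, c)` the polar set of `g` contains a finite set `F` of
non-degenerate zeros of the polar system (same Jacobian as in stub 1), then off EVERY hypersurface
`Φ = 0` of the data space `(ℂ^N)³` there is a datum whose polar set contains at least `|F|` points.
Why true: the polar system `G(u; x, s, t) = (g(x), (∂ᵢg(x) − s aᵢ − t bᵢ)ᵢ, c·x − 1)` is polynomial,
hence strictly differentiable, in `(u, x, s, t)`; at `u* = (a,b,c)` each `x ∈ F` (with its unique
`(s,t)`, or any if `a ∥ b`) is a zero with invertible `∂G/∂(x,s,t)` — the displayed block matrix up to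
row order and the sign of two columns — so the implicit function theorem
(`HasStrictFDerivAt.implicitFunction` over `ℂ`) gives continuous solution branches `x_F(u)` on a
neighbourhood `W` of `u*`, pairwise distinct and with `∇g ≠ 0` for `W` small (open conditions), i.e.
`≥ |F|` polar points for every `u ∈ W`; finally `{Φ ≠ 0} ∩ W ≠ ∅` because a polynomial vanishing on a
non-empty open subset of `ℂ^{3N}` is zero (`MvPolynomial.funext`-type identity principle, one variable
at a time).  `F = ∅`: any `u` with `Φ(u) ≠ 0` (exists as `Φ ≠ 0` over the infinite field `ℂ`).
Size L (~500 lines: IFT plumbing for polynomial maps `ℂ^{3N} × ℂ^{N+2} → ℂ^{N+2}`, openness, identity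
principle).  [folklore; Kleiman1974 for context] -/
theorem stub_polarPersistence {N : ℕ} (g : MvPolynomial (Fin N) ℂ) (a b c : Fin N → ℂ)
    (F : Finset (Fin N → ℂ))
    (hF : ∀ x ∈ F, x ∈ polarSet g a b c ∧
      (Matrix.fromBlocks
        (Matrix.of fun i j : Fin N => eval x (pderiv i (pderiv j g)))
        (Matrix.of fun (i : Fin N) (l : Fin 2) => ![a i, b i] l)
        (Matrix.of fun (l : Fin 2) (j : Fin N) => ![eval x (pderiv j g), c j] l)
        (0 : Matrix (Fin 2) (Fin 2) ℂ)).det ≠ 0)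
    (Φ : MvPolynomial (Fin 3 × Fin N) ℂ) (hΦ : Φ ≠ 0) :
    ∃ u : Fin 3 × Fin N → ℂ, eval u Φ ≠ 0 ∧
      ∃ F' : Finset (Fin N → ℂ),
        (↑F' : Set (Fin N → ℂ)) ⊆
            polarSet g (fun i => u (0, i)) (fun i => u (1, i)) (fun i => u (2, i)) ∧
          F.card ≤ F'.card :=
  Summit.ValiantsHypothesis.ValiantsHypothesis.Theorems.DetQPDetqpSuperquadratic.stub_polarPersistence g a b c F hF Φ hΦ

/-- **Stub 3 — LANDED p102483 (`Theorems/DetQPDetqpSuperquadraticStubPolarGenericFinite.lean` + helper `…PolarGenericFibres.lean` p98764: generic finiteness of fibres by a transcendence-degree count and Springer 5.1.6(ii), wave 1)** (general, TRUE: generic finiteness of polar sets) — a form has finitely many polar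
points for generic pencil/chart data.**  For `g` homogeneous (any degree, `g = 0` allowed) in `N`
variables there is a non-zero polynomial `Φ` in the data `(a, b, c)` off whose zero set the polar set
`T_g(a,b,c)` is finite.
Why true: let `X = V(g) ⊂ ℙ^{N-1}` and `C = closure {([x], [∇g(x)]) : g(x) = 0, ∇g(x) ≠ 0} ⊂ ℙ^{N-1} ×
(ℙ^{N-1})^∨` its conormal variety, of pure dimension `N − 2`; the incidence
`I = {(p, ℓ) : p ∈ C, π₂(p) ∈ ℓ}` over the Grassmannian of lines `ℓ ⊂ (ℙ^{N-1})^∨` has dimension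
`(N−2) + (N−2) = dim Gr(1, N−1)`, so by upper semicontinuity of fibre dimension for the proper map
`I → Gr` the lines with infinite fibre form a proper closed subset; `(a, b) ↦ ⟨a, b⟩` is dominant onto
`Gr`, so off a hypersurface in `(a, b)` the projective polar locus is finite, and each of its points
`[x]` has at most one representative on the chart `c·x = 1` (for every `c`).  Degenerate cases
(`N ≤ 2`, `g = 0`, `d ≤ 1`) are finite for all data; `Φ := 1` when nothing is excluded.
Size XL in Lean (dimension theory of quasi-projective varieties: generic fibre dimension /
Chevalley; alternatively elimination theory via resultants on the explicit system) — a reusable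
library fact, independent of the permanent.  [Kleiman1974; Fulton1998 Ch. 12; Piene1978 §1] -/
theorem stub_polarGenericFinite {N d : ℕ} (g : MvPolynomial (Fin N) ℂ) (hg : g.IsHomogeneous d) :
    ∃ Φ : MvPolynomial (Fin 3 × Fin N) ℂ, Φ ≠ 0 ∧ ∀ u : Fin 3 × Fin N → ℂ, eval u Φ ≠ 0 →
      (polarSet g (fun i => u (0, i)) (fun i => u (1, i)) (fun i => u (2, i))).Finite :=
  Summit.ValiantsHypothesis.ValiantsHypothesis.Theorems.DetQPDetqpSuperquadratic.stub_polarGenericFinite g hg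

/-- **Stub 4 — LANDED p97537 (`Theorems/DetQPDetqpSuperquadraticStubBezoutGrowth.lean`, wave 1)** (arithmetic, TRUE) — growth of Sheshadri's two-kernel Bézout number along the ladder.**
For `0 < θ < ε` and all large `n`: if `k ≥ n^{1+ε}` and `n^{(1-θ)k} ≤ B(m, k+2)` then
`m ≥ n^{2+(ε-θ)/2}`.
Why true: `B(m, N') = Σ_{i=1}^{N'-1} C(m,i) C(m-1,N'-1-i) C(N'-2,i-1) ≤ 2^{N'-2} Σ_i C(m,i)C(m-1,N'-1-i)
= 2^{N'-2} C(2m-1, N'-1)` (Vandermonde, `Nat.add_choose_eq`), and `C(2m-1,k+1) ≤ (2m)^{k+1}/(k+1)!`,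
`(k+1)! ≥ ((k+1)/e)^{k+1}` (`Real.pow_div_factorial_le_exp` at `x = k+1`), so
`B(m,k+2) ≤ ½ (4em/(k+1))^{k+1}`.  If `m < n^{2+(ε-θ)/2}` then, as `k + 1 > n^{1+ε}`,
`4em/(k+1) < 4e·n^{1-θ}·n^{-(ε-θ)/2}`, whence `B(m,k+2) < ½ (4e n^{-(ε-θ)/2})^{k+1} n^{(1-θ)(k+1)}
≤ n^{(1-θ)k}` as soon as `n^{(ε-θ)/2} ≥ 8e` (then `2·(n^{(ε-θ)/2}/4e)^{k+1} ≥ 2^{k+2} ≥ 2^n ≥ n ≥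
n^{1-θ}`), contradicting the hypothesis; no `(k+1)`-th roots are needed.  `n = 0` is vacuous/trivial
(`0^{2+…} = 0`).  Numbers (exact, triage r1-1/r1-3): least `m` with `B(m,k+2) ≥ ½·n(n-1)^k` is
`≈ 1.1·kn/(4e)` (n=20: k=80/120/160/200 → 174/254/335/415; n=30: k=120/180/240/300 →
371/548/724/899).  Size M (~250 lines of real-analysis bookkeeping: `Real.rpow` algebra,
`Nat.choose` bounds, `Nat.factorial` vs `exp`).  [arXiv:2606.13628 Thm 3(i) Step 6 (closed form of
B); folklore estimates] -/
theorem stub_bezoutGrowth (ε θ : ℝ) (hθ : 0 < θ) (hθε : θ < ε) :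
    ∃ n₁ : ℕ, ∀ n ≥ n₁, ∀ k m : ℕ, (n : ℝ) ^ (1 + ε) ≤ (k : ℝ) →
      (n : ℝ) ^ ((1 - θ) * (k : ℝ)) ≤ (conormalBezout m (k + 2) : ℝ) →
        (n : ℝ) ^ (2 + (ε - θ) / 2) ≤ (m : ℝ) :=
  Summit.ValiantsHypothesis.ValiantsHypothesis.Theorems.DetQPDetqpSuperquadratic.stub_bezoutGrowth ε θ hθ hθε

/-! ## v2 (lead c1): the NON-DEGENERATE route — two further registered stubs replacing generic finiteness (BOTH LANDED: p101995, p107629; and the finiteness route's stubs 2, 3, 4 are landed too: p98143, p102483, p97537 — the line is closed modulo `stub_sectionalWitness` by either route)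

The tree's Sheshadri bound is an `ncard` bound and needs finiteness of the polar set at the datum (stub 3, XL library
algebraic geometry).  The ND route counts only NON-DEGENERATE polar points, which the multigraded refined Bézout count
bounds directly (a non-degenerate multiprojective zero gives a MINIMAL multi-cone prime: Nakayama in `S_𝔓`), so neither
finiteness nor dimension theory of fibres is needed: stub 2′ (persistence keeping non-degeneracy, same IFT as stub 2) and
stub 3′ (Sheshadri's bound for finite sets of non-degenerate polar points, generic pencil).  Composition
`detqpSuperquadratic_of_ND`: stub 1 → stub 2′ (at Φ := Φ_A of stub 3′ for the attained representation of the section) →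
stub 3′ → stub 4. -/

/-- **Stub 2′ — LANDED p101995 (`Theorems/DetQPDetqpSuperquadraticStubPolarPersistenceND.lean`, wave 2)** (general, TRUE) — persistence of non-degenerate polar points, keeping non-degeneracy.  As stub 2, but
the finite set `F'` at the new datum `u` consists of NON-DEGENERATE polar points (the same bordered-Hessian Jacobian,
at `u`): non-degeneracy is an open condition along the implicit-function branches.  Size L (a corollary of stub 2's
proof). [folklore] -/
theorem stub_polarPersistenceND {N : ℕ} (g : MvPolynomial (Fin N) ℂ) (a b c : Fin N → ℂ)
    (F : Finset (Fin N → ℂ))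
    (hF : ∀ x ∈ F, x ∈ polarSet g a b c ∧
      (Matrix.fromBlocks
        (Matrix.of fun i j : Fin N => eval x (pderiv i (pderiv j g)))
        (Matrix.of fun (i : Fin N) (l : Fin 2) => ![a i, b i] l)
        (Matrix.of fun (l : Fin 2) (j : Fin N) => ![eval x (pderiv j g), c j] l)
        (0 : Matrix (Fin 2) (Fin 2) ℂ)).det ≠ 0)
    (Φ : MvPolynomial (Fin 3 × Fin N) ℂ) (hΦ : Φ ≠ 0) :
    ∃ u : Fin 3 × Fin N → ℂ, eval u Φ ≠ 0 ∧
      ∃ F' : Finset (Fin N → ℂ), F.card ≤ F'.card ∧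
        ∀ x ∈ F', x ∈ polarSet g (fun i => u (0, i)) (fun i => u (1, i)) (fun i => u (2, i)) ∧
          (Matrix.fromBlocks
            (Matrix.of fun i j : Fin N => eval x (pderiv i (pderiv j g)))
            (Matrix.of fun (i : Fin N) (l : Fin 2) => ![u (0, i), u (1, i)] l)
            (Matrix.of fun (l : Fin 2) (j : Fin N) => ![eval x (pderiv j g), u (2, j)] l)
            (0 : Matrix (Fin 2) (Fin 2) ℂ)).det ≠ 0 :=
  Summit.ValiantsHypothesis.ValiantsHypothesis.Theorems.DetQPDetqpSuperquadratic.stub_polarPersistenceND g a b c F hF Φ hΦ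

/-- **Stub 3′ — LANDED p107629 (`Theorems/DetQPDetqpSuperquadraticStubPolarCountND.lean` + helpers `…PolarCountND{Jacobian p103796, Tangent p104746, KernelLift p104747, KernelSystem p104748}.lean`, wave 2)** (det side, TRUE) — Sheshadri's two-kernel Bézout bound for NON-DEGENERATE polar points.  For a form
`f` in `N ≥ 3` variables with an affine determinantal representation of size `m`, for pencil/chart data off a
hypersurface `{Φ = 0}` (a ∦ b and the `N − 2` pencil equations of the kernel-incidence system non-trivial), every
finite set of non-degenerate polar points has at most `B(m, N)` elements — WITHOUT assuming the polar set finite.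
Route: the assembly of `Sheshadri2026_polarCount_le_holds` (DeterminantalConormalBoundMixed.lean) with `T` = the kernel
lifts of the given points and, in place of the isolation hypothesis `hiso`, minimality of the multi-cone primes `𝔓_z`
over the system ideal from non-degeneracy (Jacobian of full rank `n − |ι|` at `z` ⇒ the images of the equations span
`𝔪/𝔪²` in the regular local ring `S_𝔓` (𝔓_z is generated by block binomials, i.e. by `n − |ι|` independent linear
forms) ⇒ `𝔞S_𝔓 = 𝔪` by Nakayama ⇒ 𝔓_z minimal), then the tree's `card_le_mixedBezout` +
`hilbert_inf_multiCone_eq_card` + `coeff_generatingFunction_eq_conormalBezout`; plus the block elimination relating the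
polar-system Jacobian at `x` to the kernel-system Jacobian at its lift.  Size XL but theory-free (Nakayama, localisation,
linear algebra).  [cite: Fulton1998, Example 12.3.1; Sheshadri2026Border §3.1] -/
theorem stub_polarCountND {N : ℕ} (hN : 3 ≤ N) (f : MvPolynomial (Fin N) ℂ) (d m : ℕ)
    (hf : f.IsHomogeneous d) (hm : HasDetRepr f m) :
    ∃ Φ : MvPolynomial (Fin 3 × Fin N) ℂ, Φ ≠ 0 ∧ ∀ u : Fin 3 × Fin N → ℂ, eval u Φ ≠ 0 →
      ∀ T : Finset (Fin N → ℂ),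
        (∀ x ∈ T, x ∈ polarSet f (fun i => u (0, i)) (fun i => u (1, i)) (fun i => u (2, i)) ∧
          (Matrix.fromBlocks
            (Matrix.of fun i j : Fin N => eval x (pderiv i (pderiv j f)))
            (Matrix.of fun (i : Fin N) (l : Fin 2) => ![u (0, i), u (1, i)] l)
            (Matrix.of fun (l : Fin 2) (j : Fin N) => ![eval x (pderiv j f), u (2, j)] l)
            (0 : Matrix (Fin 2) (Fin 2) ℂ)).det ≠ 0) →
        T.card ≤ conormalBezout m N :=
  Summit.ValiantsHypothesis.ValiantsHypothesis.Theorems.DetQPDetqpSuperquadratic.stub_polarCountND hN f d m hf hm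

/-! ## Det side (PROVED): the rung of the ladder, from the discharged Sheshadri fact -/

/-- Determinantal representations survive substitution of affine-linear forms: the restriction of a
polynomial with `HasDetRepr _ m` to a linear subspace keeps `HasDetRepr _ m`
(proof as in `HasDetRepr.of_isProjection_holds`). -/
theorem hasDetRepr_aeval_of_totalDegree_le_one {σ τ : Type*} {f : MvPolynomial σ ℂ} {m : ℕ}
    (h : HasDetRepr f m) (a : σ → MvPolynomial τ ℂ) (ha : ∀ i, (a i).totalDegree ≤ 1) :
    HasDetRepr (aeval a f) m := by
  obtain ⟨A, hA, rfl⟩ := h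
  refine ⟨(aeval a).mapMatrix A, fun i j => ?_, (AlgHom.map_det _ _).symm⟩
  rw [AlgHom.mapMatrix_apply, Matrix.map_apply]
  exact (HasDetRepr.totalDegree_aeval_le_of_le_one a ha _).trans (hA i j)

/-- **Rung `k` of the ladder (det side, unconditional).**  For every linear restriction `L` of
`per_n` to `k + 2 ≥ 3` variables with `per_n ∘ L` homogeneous of degree `n`, and every affine
determinantal representation of `per_n` of size `m`, the polar count of `per_n ∘ L` is at most
`B(m, k+2)` for all pencil/chart data off a hypersurface.  This is `Sheshadri2026_polarCount_le_holds`
(DeterminantalConormalBoundMixed.lean) applied to `aeval L per_n`, which keeps `HasDetRepr _ m`. -/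
theorem ladder_rung {n k m : ℕ} (hk : 1 ≤ k)
    (L : Fin n × Fin n → MvPolynomial (Fin (k + 2)) ℂ) (hL : ∀ ij, (L ij).totalDegree ≤ 1)
    (hhom : (aeval L (perPoly (Fin n) ℂ)).IsHomogeneous n)
    (hm : HasDetRepr (perPoly (Fin n) ℂ) m) :
    ∃ Φ : MvPolynomial (Fin 3 × Fin (k + 2)) ℂ, Φ ≠ 0 ∧
      ∀ u : Fin 3 × Fin (k + 2) → ℂ, eval u Φ ≠ 0 →
        (polarSet (aeval L (perPoly (Fin n) ℂ)) (fun i => u (0, i)) (fun i => u (1, i))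
            (fun i => u (2, i))).ncard ≤ conormalBezout m (k + 2) := by
  have h3 : 3 ≤ Fintype.card (Fin (k + 2)) := by simp; omega
  simpa using Sheshadri2026_polarCount_le_holds h3 (aeval L (perPoly (Fin n) ℂ)) n m hhom
    (hasDetRepr_aeval_of_totalDegree_le_one hm L hL)

/-! ## The transfer statement C⁺ and the two compositions -/

/-- **C⁺ — the sectional class bound `SC(ε, θ)`** (the card's `SectionalClassConjecture`, sharpened as
the triage asked: window exponent `ε` and base loss `θ` decoupled, a single rung `k ≥ n^{1+ε}`, robust
base `n^{(1-θ)k}`): for all large `n` some `(k+2)`-variable linear section of `per_n` with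
`k ≥ n^{1+ε}` has, off every hypersurface of pencil/chart data, a datum with at least `n^{(1-θ)k}`
polar points (counted by `Set.ncard`, so the polar set there is finite and the bound is the generic
class of the section). -/
def SectionalClassBound (ε θ : ℝ) : Prop :=
  ∃ n₀ : ℕ, ∀ n ≥ n₀, ∃ k : ℕ, (n : ℝ) ^ (1 + ε) ≤ (k : ℝ) ∧
    ∃ L : Fin n × Fin n → MvPolynomial (Fin (k + 2)) ℂ, (∀ ij, (L ij).IsHomogeneous 1) ∧
      ∀ Φ : MvPolynomial (Fin 3 × Fin (k + 2)) ℂ, Φ ≠ 0 →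
        ∃ u : Fin 3 × Fin (k + 2) → ℂ, eval u Φ ≠ 0 ∧
          (n : ℝ) ^ ((1 - θ) * (k : ℝ)) ≤
            ((polarSet (aeval L (perPoly (Fin n) ℂ)) (fun i => u (0, i)) (fun i => u (1, i))
                (fun i => u (2, i))).ncard : ℝ)

/-- **Per side assembled:** stubs 1–3 give `SC(ε, θ)` for some `0 < θ < ε`. -/
theorem exists_sectionalClassBound :
    ∃ ε θ : ℝ, 0 < θ ∧ θ < ε ∧ SectionalClassBound ε θ := by
  obtain ⟨ε, θ, hθ, hθε, n₀, hW⟩ := stub_sectionalWitness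
  refine ⟨ε, θ, hθ, hθε, n₀, fun n hn => ?_⟩
  obtain ⟨k, hk, L, hL, a, b, c, F, hF, hcard⟩ := hW n hn
  refine ⟨k, hk, L, hL, fun Φ hΦ => ?_⟩
  have hhom : (aeval L (perPoly (Fin n) ℂ)).IsHomogeneous n := by
    simpa using (perPoly_isHomogeneous (n := Fin n) (k := ℂ)).aeval L hL
  obtain ⟨Φf, hΦf0, hΦf⟩ := stub_polarGenericFinite (aeval L (perPoly (Fin n) ℂ)) hhom
  obtain ⟨u, hu, F', hF'sub, hFF'⟩ :=
    stub_polarPersistence (aeval L (perPoly (Fin n) ℂ)) a b c F hF (Φ * Φf) (mul_ne_zero hΦ hΦf0)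
  rw [map_mul] at hu
  have hfin := hΦf u (right_ne_zero_of_mul hu)
  refine ⟨u, left_ne_zero_of_mul hu, hcard.trans ?_⟩
  have h1 : F'.card ≤ (polarSet (aeval L (perPoly (Fin n) ℂ)) (fun i => u (0, i))
      (fun i => u (1, i)) (fun i => u (2, i))).ncard := by
    calc F'.card = (↑F' : Set (Fin (k + 2) → ℂ)).ncard := (Set.ncard_coe_finset F').symm
      _ ≤ _ := Set.ncard_le_ncard hF'sub hfin
  exact_mod_cast hFF'.trans h1

/-- **Transfer: C⁺ ⟹ crux.**  `SC(ε, θ)` with `0 < θ < ε` implies `dc(per_n) ≥ n^{2+(ε-θ)/2}`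
eventually, through the proved rung (`ladder_rung`, i.e. Sheshadri's bound on every section, with
`m = dc(per_n)` attained by `hasDetRepr_determinantalComplexity_holds`) and the growth stub.  The
conclusion is the crux statement UNFOLDED (with the explicit exponent `ε' = (ε-θ)/2` available from
the proof); `DetqpSuperquadratic_of` below restates it under the route's name, so that exactly one
theorem of this file has the crux decl as its head. -/
theorem detqpSuperquadratic_of_sectionalClassBound {ε θ : ℝ} (hθ : 0 < θ) (hθε : θ < ε)
    (h : SectionalClassBound ε θ) :
    ∃ ε' : ℝ, 0 < ε' ∧ ∃ n₀ : ℕ, ∀ n ≥ n₀,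
      (n : ℝ) ^ (2 + ε') ≤ (determinantalComplexity (perPoly (Fin n) ℂ) : ℝ) := by
  obtain ⟨n₀, hSC⟩ := h
  obtain ⟨n₁, hA⟩ := stub_bezoutGrowth ε θ hθ hθε
  refine ⟨(ε - θ) / 2, by linarith, max n₀ n₁, fun n hn => ?_⟩
  have hn₀ : n₀ ≤ n := le_of_max_le_left hn
  have hn₁ : n₁ ≤ n := le_of_max_le_right hn
  set m := determinantalComplexity (perPoly (Fin n) ℂ) with hm_def
  rcases Nat.eq_zero_or_pos n with rfl | hnpos
  · have hexp : (2 + (ε - θ) / 2 : ℝ) ≠ 0 := by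
      have : (0 : ℝ) < 2 + (ε - θ) / 2 := by linarith
      exact this.ne'
    rw [Nat.cast_zero, Real.zero_rpow hexp]
    exact Nat.cast_nonneg _
  obtain ⟨k, hk, L, hL, hgen⟩ := hSC n hn₀
  have hk1 : 1 ≤ k := by
    have h1 : (1 : ℝ) ≤ (n : ℝ) ^ (1 + ε) :=
      Real.one_le_rpow (by exact_mod_cast hnpos) (by linarith)
    exact_mod_cast h1.trans hk
  have hhom : (aeval L (perPoly (Fin n) ℂ)).IsHomogeneous n := by
    simpa using (perPoly_isHomogeneous (n := Fin n) (k := ℂ)).aeval L hL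
  have hL1 : ∀ ij, (L ij).totalDegree ≤ 1 := fun ij => (hL ij).totalDegree_le
  have hm : HasDetRepr (perPoly (Fin n) ℂ) m := hasDetRepr_determinantalComplexity_holds _
  obtain ⟨ΦS, hΦS0, hΦS⟩ := ladder_rung hk1 L hL1 hhom hm
  obtain ⟨u, hu, hcount⟩ := hgen ΦS hΦS0
  have hB := hΦS u hu
  exact hA n hn₁ k m hk (hcount.trans (by exact_mod_cast hB))

/-- **Transfer, ND route (v2): stubs 1, 2′, 3′, 4 ⟹ the crux (unfolded).**  No finiteness of polar sets is used:
the certificate's non-degenerate points persist (as non-degenerate points) to a datum off the bad hypersurface `Φ_A` of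
the attained representation of the section, where stub 3′ bounds them by `B(dc(per_n), k+2)`. -/
theorem detqpSuperquadratic_of_ND :
    ∃ ε' : ℝ, 0 < ε' ∧ ∃ n₀ : ℕ, ∀ n ≥ n₀,
      (n : ℝ) ^ (2 + ε') ≤ (determinantalComplexity (perPoly (Fin n) ℂ) : ℝ) := by
  obtain ⟨ε, θ, hθ, hθε, n₀, hW⟩ := stub_sectionalWitness
  obtain ⟨n₁, hA⟩ := stub_bezoutGrowth ε θ hθ hθε
  refine ⟨(ε - θ) / 2, by linarith, max n₀ n₁, fun n hn => ?_⟩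
  have hn₀ : n₀ ≤ n := le_of_max_le_left hn
  have hn₁ : n₁ ≤ n := le_of_max_le_right hn
  set m := determinantalComplexity (perPoly (Fin n) ℂ) with hm_def
  rcases Nat.eq_zero_or_pos n with rfl | hnpos
  · have hexp : (2 + (ε - θ) / 2 : ℝ) ≠ 0 := by
      have : (0 : ℝ) < 2 + (ε - θ) / 2 := by linarith
      exact this.ne'
    rw [Nat.cast_zero, Real.zero_rpow hexp]
    exact Nat.cast_nonneg _
  obtain ⟨k, hk, L, hL, a, b, c, F, hF, hcard⟩ := hW n hn₀
  have hk1 : 1 ≤ k := by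
    have h1 : (1 : ℝ) ≤ (n : ℝ) ^ (1 + ε) :=
      Real.one_le_rpow (by exact_mod_cast hnpos) (by linarith)
    exact_mod_cast h1.trans hk
  have hhom : (aeval L (perPoly (Fin n) ℂ)).IsHomogeneous n := by
    simpa using (perPoly_isHomogeneous (n := Fin n) (k := ℂ)).aeval L hL
  have hL1 : ∀ ij, (L ij).totalDegree ≤ 1 := fun ij => (hL ij).totalDegree_le
  have hmrep : HasDetRepr (aeval L (perPoly (Fin n) ℂ)) m :=
    hasDetRepr_aeval_of_totalDegree_le_one (hasDetRepr_determinantalComplexity_holds _) L hL1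
  obtain ⟨Φ, hΦ0, hΦ⟩ := stub_polarCountND (N := k + 2) (by omega) (aeval L (perPoly (Fin n) ℂ)) n m hhom hmrep
  obtain ⟨u, hu, F', hFF', hF'⟩ := stub_polarPersistenceND (aeval L (perPoly (Fin n) ℂ)) a b c F hF Φ hΦ0
  have hB : F'.card ≤ conormalBezout m (k + 2) := hΦ u hu F' hF'
  have h2 : (n : ℝ) ^ ((1 - θ) * (k : ℝ)) ≤ (conormalBezout m (k + 2) : ℝ) :=
    hcard.trans (by exact_mod_cast hFF'.trans hB)
  exact hA n hn₁ k m hk h2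

/-- **The skeleton theorem (v2): the crux BY NAME, via the ND route** — stubs 1 (`stub_sectionalWitness`, the
conjecture — the ONLY open stub), 2′ (`stub_polarPersistenceND`, LANDED p101995), 3′ (`stub_polarCountND`, LANDED p107629),
4 (`stub_bezoutGrowth`, LANDED p97537); sorries only inside `stub_*` (the landed ones are `sorry -- LANDED` placeholders until the
farm has built their modules; then `exact Summit.….Theorems.DetQPDetqpSuperquadratic.stub_…`). -/
theorem DetqpSuperquadratic_of :
    Summit.ValiantsHypothesis.ValiantsHypothesis.Theses.DetQP.DetqpSuperquadratic :=
  detqpSuperquadratic_of_ND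

/-- The v1 (finiteness) route to the same conclusion — ALL ITS TRUE STUBS ARE LANDED (2: p98143, 3: p102483, 4: p97537), so this
theorem is closed modulo `stub_sectionalWitness` alone (imports replace the `sorry` placeholders once the farm has built the modules). -/
theorem DetqpSuperquadratic_of_finiteRoute :
    Summit.ValiantsHypothesis.ValiantsHypothesis.Theses.DetQP.DetqpSuperquadratic := by
  obtain ⟨ε, θ, hθ, hθε, h⟩ := exists_sectionalClassBound
  exact detqpSuperquadratic_of_sectionalClassBound hθ hθε h

end

end Summit.ValiantsHypothesis.ValiantsHypothesis.Cruxes.DetqpSuperquadratic.SectionalClassLadder
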